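import Literature.MathematicalPhysics.QuantumFieldTheory.Balaban1983to89.B7Prop7RegimeNonVacuity
import Literature.MathematicalPhysics.QuantumFieldTheory.Balaban1983to89.B7Prop5GeneralLevels
import Literature.MathematicalPhysics.QuantumFieldTheory.Balaban1983to89.B7Prop5CplxLevels
import Literature.MathematicalPhysics.QuantumFieldTheory.Balaban1983to89.B11Eq44COperatorTower

/-!
# `Balaban1983to89.B7Prop7RegimeNonVacuityClassFaces` — T. Bałaban, *Averaging operations for lattice gauge theories*, Commun. Math. Phys. **98** (1985) 17–51 [Balaban1985Averaging]
# Proposition 2 (52) p. 26, Proposition 4 (130)–(133) p. 38, Proposition 5 (155)–(157) pp. 41–42, Proposition 7 (164) p. 43 («α₀, α₁ sufficiently small»); [Balaban1985Variational]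
# (44) p. 285, (52) p. 285: **THE FULL NUMERICS PACK OF THE CELL's CLASS-LEVEL CHART FACES IS JOINTLY SATISFIABLE FOR EVERY DIMENSION AND EVERY `L ≥ 1`** — the smallness
# side-conditions DISPLAYED by `Support/NE9CurChartTowerPiLipschitzAtFlatLatticeUniformClassW80{,TopLevel}`, `Support/NE9CurChartTowerPiOneChartClassW80{,TopLevel}` and their
# Lit packages `B11Eq174ChartRegimesLipschitzAtFlatW80{LatticeFree,UnitaryClass}` (this lineage, gens 104–106): `C₀α₀ ≤ 1∕3`, `4α₀, 8α₀ ≤ c₂′`, the right-inverse regime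
# `50(d+1)·αT·L^d ≤ ½`, Prop. 4's `e^{4·800(d+1)²(d+4)α₀}(1 + 8C₁ρ) ≤ 2` with `4ρ ≤ c₃`, the general-level letters `2d·θ_gen ≤ L³∕16`, `2d·C₃^gen·ρ ≤ 1`, Prop. 7's polydisc pack
# at the coarse radius `r′` (`…(1 + 8C₁r′) ≤ 2`, `2r′ ≤ c₃`, `409600(d+1)²r′ ≤ 1`, `e^{4480(d+1)²(d+4)α₀ + 240000(d+1)³r′}(1 + 8C₁′ρ) ≤ 2`), the complex Prop. 5's `16ρ < c₃`,
# `d·C₃^cplx·ρ ≤ 1` and its HEIGHT-FREE transport numerics `ε^cplx(r′) ≤ 1∕16`, `d·(ε^cplx(r′) + τ^cplx(α₀, r′)) ≤ 1∕16` — ALL AT ONCE for explicit positive `α₀, ρ, r′`.  So the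
# `∃`-first blocks of those faces are not vacuous in their numerics.  Elementary: the sibling `B7Prop7RegimeNonVacuity.exists_regime_numerics` (gen 104) gives `(α₀, ρ, r′, r₇)` for the
# exponential members; every other member is linear with nonnegative slope in ONE of `α₀, ρ, r′`, so shrinking by `min` keeps the pack (monotonicity of `exp` and of products).
# NE9 crux-team LEAF PROVER 01 (`b2b-balaban-t4-ne9-formalise-leaf-01`), gen 106; cell `pub-balaban`∕`t4`, row NE9, bears_on R4/N22.  WHAT IS PROVED (sorry-free; 0 `def`):
# `epsCplx_zero_eq`, `tauCplx_zero_eq` (the height-0 closed forms), **`exists_classFace_numerics`**.  HONEST SCOPE: [folklore] arithmetic on the tree's constants `C0`, `c2'`, `c3`,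
# `αT`, `thetaGen`, `C3Gen`, `C3Cplx`, `epsCplx`, `tauCplx`; nothing of print is asserted; crude (NOT print's optimal `α₀`).  HONEST DEPENDENCY (cell line): continuum YM on T⁴ ⇐
# BetaPertH ∧ nine spine estimates (0/9 proved); BetaPertH ⇐ (D1) ∧ (D4) ∧ CAP+tail; G-an2-4 gates asym, D1 and NE2/3/4.

statement-level skeleton of published theorems with citation tags; proofs where landed; nothing here is a claim about the Yang–Mills mass gap
-/

noncomputable section

namespace Literature.MathematicalPhysics.QuantumFieldTheory.Balaban1983to89.B7Prop7RegimeNonVacuityClassFaces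

open B7Prop2Explicit (C0 c2' C0_pos c2'_pos)
open B7Prop3Flat (c3 c3_pos)
open B7Prop5GeneralLevels (thetaGen C3Gen)
open B7Prop5CplxLevels (epsCplx tauCplx C3Cplx)
open B11Eq44COperatorTower (αT)
open B7Prop7RegimeNonVacuity (exists_regime_numerics)

/-- The transport excess at height `0`: `ε^cplx(d, L, b′, 0) = 6·(2dL+2L)·400(d+1)·b′` — LINEAR in `b′`. [cite: Balaban1985Averaging, Proposition 7 p.43, (164) p.43] -/
theorem epsCplx_zero_eq (d L : ℕ) (b' : ℝ) :
    epsCplx d L b' 0 = (6 * (((2 * (d * L) + L + L : ℕ) : ℝ) * (400 * ((d : ℝ) + 1)))) * b' := by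
  unfold epsCplx; ring

/-- The `Q″`-coefficient at heights `j = k = 0`: `τ^cplx = (140·32(d+1)(d+4)L²·α₀ + 280·(2dL+2L)·400(d+1)·b′)·L^d·L⁻¹` — LINEAR in `(α₀, b′)`.
[cite: Balaban1985Averaging, Proposition 7 p.43, (144) p.40] -/
theorem tauCplx_zero_eq (d L : ℕ) (α₀ b' : ℝ) :
    tauCplx d L α₀ 0 b' 0 = (140 * (32 * ((d : ℝ) + 1) * ((d : ℝ) + 4) * (L : ℝ) ^ 2) * (L : ℝ) ^ d * (L : ℝ)⁻¹) * α₀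
      + (280 * (((2 * (d * L) + L + L : ℕ) : ℝ) * (400 * ((d : ℝ) + 1))) * (L : ℝ) ^ d * (L : ℝ)⁻¹) * b' := by
  unfold tauCplx; simp only [pow_zero, inv_one, mul_one, one_pow]; ring

set_option maxHeartbeats 1600000 in
/-- **THE CLASS FACES' NUMERICS ARE JOINTLY SATISFIABLE**: for every `d` and `L ≥ 1` there are `α₀, ρ, r′ > 0` meeting the sixteen displayed smallness hypotheses of the
cell's class-level chart faces at once (list in the module header). [folklore]
[cite: Balaban1985Averaging, Proposition 2 (52) p.26, Proposition 4 (130)–(133) p.38, Proposition 5 (155)–(157) pp.41–42, Proposition 7 p.43; Balaban1985Variational, (44) p.285, (52) p.285] -/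
theorem exists_classFace_numerics (d L : ℕ) (hL : 1 ≤ L) :
    ∃ α₀ ρ r' : ℝ, 0 < α₀ ∧ 0 < ρ ∧ 0 < r' ∧
      C0 d * α₀ ≤ 1 / 3 ∧ 4 * α₀ ≤ c2' d L ∧ 8 * α₀ ≤ c2' d L ∧ 50 * (d + 1) * αT d L α₀ * (L : ℝ) ^ d ≤ 1 / 2 ∧
      Real.exp (4 * (800 * ((d : ℝ) + 1) ^ 2 * ((d : ℝ) + 4)) * α₀) * (1 + 8 * (131072 * ((d : ℝ) + 1) ^ 2) * ρ) ≤ 2 ∧ 4 * ρ ≤ c3 d L ∧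
      2 * d * thetaGen d L α₀ ≤ (L : ℝ) ^ 3 / 16 ∧ 2 * d * C3Gen d L * ρ ≤ 1 ∧
      Real.exp (4 * (800 * ((d : ℝ) + 1) ^ 2 * ((d : ℝ) + 4)) * α₀) * (1 + 8 * (131072 * ((d : ℝ) + 1) ^ 2) * r') ≤ 2 ∧ 2 * r' ≤ c3 d L ∧
      409600 * ((d : ℝ) + 1) ^ 2 * r' ≤ 1 ∧
      Real.exp (4480 * ((d : ℝ) + 1) ^ 2 * ((d : ℝ) + 4) * α₀ + 240000 * ((d : ℝ) + 1) ^ 3 * r') * (1 + 8 * (2097152 * ((d : ℝ) + 1) ^ 2) * ρ) ≤ 2 ∧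
      16 * ρ < c3 d L ∧ (d : ℝ) * C3Cplx d L * ρ ≤ 1 ∧
      epsCplx d L r' 0 ≤ 1 / 16 ∧ (d : ℝ) * (epsCplx d L r' 0 + tauCplx d L α₀ 0 r' 0) ≤ 1 / 16 := by
  obtain ⟨a, p, r, r₇, ha, hp, hr, hr₇, h1, h2, h3, h4, h5, h6, h7, h8, h9⟩ := exists_regime_numerics d L hL
  have hL0 : (0 : ℝ) < L := by exact_mod_cast lt_of_lt_of_le zero_lt_one hL
  have hL1 : (1 : ℝ) ≤ L := by exact_mod_cast hL
  have hc3 := c3_pos d hL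
  have hd0 : (0 : ℝ) ≤ d := Nat.cast_nonneg d
  -- the slopes of the linear members
  obtain ⟨Q, hQ0, hQ⟩ : ∃ Q : ℝ, 0 ≤ Q ∧ Q = 50 * ((d : ℝ) + 1) * (32 * ((d : ℝ) + 1) * ((d : ℝ) + 4) * (L : ℝ) ^ 2) * (L : ℝ) ^ d := ⟨_, by positivity, rfl⟩
  obtain ⟨P, hP0, hP⟩ : ∃ P : ℝ, 0 ≤ P ∧ P = 2 * (d : ℝ) * (3200 * ((d : ℝ) + 1) * ((d : ℝ) + 4) * (L : ℝ) ^ (d + 1)) := ⟨_, by positivity, rfl⟩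
  obtain ⟨E, hE0, hE⟩ : ∃ E : ℝ, 0 ≤ E ∧ E = 6 * (((2 * (d * L) + L + L : ℕ) : ℝ) * (400 * ((d : ℝ) + 1))) := ⟨_, by positivity, rfl⟩
  obtain ⟨A, hA0, hA⟩ : ∃ A : ℝ, 0 ≤ A ∧ A = 140 * (32 * ((d : ℝ) + 1) * ((d : ℝ) + 4) * (L : ℝ) ^ 2) * (L : ℝ) ^ d * (L : ℝ)⁻¹ := ⟨_, by positivity, rfl⟩
  obtain ⟨B, hB0, hB⟩ : ∃ B : ℝ, 0 ≤ B ∧ B = 280 * (((2 * (d * L) + L + L : ℕ) : ℝ) * (400 * ((d : ℝ) + 1))) * (L : ℝ) ^ d * (L : ℝ)⁻¹ := ⟨_, by positivity, rfl⟩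
  have hG0 : 0 ≤ C3Gen d L := by unfold C3Gen B7Prop5GeneralLevels.C1ppGen; positivity
  have hX0 : 0 ≤ C3Cplx d L := by unfold C3Cplx B7Prop5CplxLevels.C1ppCplx; positivity
  -- the choices: shrink the sibling's `(a, p, r)` below every linear bound (`ρ` also below `r₇`)
  set α₀ : ℝ := min a (min (1 / (2 * (Q + 1))) (min ((L : ℝ) ^ 3 / (16 * (P + 1))) (1 / (32 * ((d : ℝ) * A + 1))))) with hα₀
  set ρ : ℝ := min (min p r₇) (min (c3 d L / 32) (min (1 / (2 * (d : ℝ) * C3Gen d L + 1)) (1 / ((d : ℝ) * C3Cplx d L + 1)))) with hρ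
  set r' : ℝ := min r (1 / (32 * (((d : ℝ) + 1) * (E + B) + 1))) with hr'
  have hα₀0 : 0 < α₀ := lt_min ha (lt_min (by positivity) (lt_min (by positivity) (by positivity)))
  have hρ0 : 0 < ρ := lt_min (lt_min hp hr₇) (lt_min (by positivity) (lt_min (by positivity) (by positivity)))
  have hr'0 : 0 < r' := lt_min hr (by positivity)
  have hαa : α₀ ≤ a := min_le_left _ _
  have hαQ : α₀ ≤ 1 / (2 * (Q + 1)) := (min_le_right _ _).trans (min_le_left _ _)
  have hαP : α₀ ≤ (L : ℝ) ^ 3 / (16 * (P + 1)) := (min_le_right _ _).trans ((min_le_right _ _).trans (min_le_left _ _))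
  have hαA : α₀ ≤ 1 / (32 * ((d : ℝ) * A + 1)) := (min_le_right _ _).trans ((min_le_right _ _).trans (min_le_right _ _))
  have hρp : ρ ≤ p := (min_le_left _ _).trans (min_le_left _ _)
  have hρ7 : ρ ≤ r₇ := (min_le_left _ _).trans (min_le_right _ _)
  have hρc : ρ ≤ c3 d L / 32 := (min_le_right _ _).trans (min_le_left _ _)
  have hρG : ρ ≤ 1 / (2 * (d : ℝ) * C3Gen d L + 1) := (min_le_right _ _).trans ((min_le_right _ _).trans (min_le_left _ _))
  have hρX : ρ ≤ 1 / ((d : ℝ) * C3Cplx d L + 1) := (min_le_right _ _).trans ((min_le_right _ _).trans (min_le_right _ _))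
  have hrr : r' ≤ r := min_le_left _ _
  have hrE : r' ≤ 1 / (32 * (((d : ℝ) + 1) * (E + B) + 1)) := min_le_right _ _
  -- the two exponential transfers (monotone in each letter)
  have hK₁ : (0 : ℝ) ≤ 8 * (131072 * ((d : ℝ) + 1) ^ 2) := by positivity
  have hK₂ : (0 : ℝ) ≤ 8 * (2097152 * ((d : ℝ) + 1) ^ 2) := by positivity
  have he₁ : (0 : ℝ) ≤ 4 * (800 * ((d : ℝ) + 1) ^ 2 * ((d : ℝ) + 4)) := by positivity
  have hexp₁ : Real.exp (4 * (800 * ((d : ℝ) + 1) ^ 2 * ((d : ℝ) + 4)) * α₀) ≤ Real.exp (4 * (800 * ((d : ℝ) + 1) ^ 2 * ((d : ℝ) + 4)) * a) :=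
    Real.exp_le_exp.2 (mul_le_mul_of_nonneg_left hαa he₁)
  have hexp₂ : Real.exp (4480 * ((d : ℝ) + 1) ^ 2 * ((d : ℝ) + 4) * α₀ + 240000 * ((d : ℝ) + 1) ^ 3 * r') ≤
      Real.exp (4480 * ((d : ℝ) + 1) ^ 2 * ((d : ℝ) + 4) * a + 240000 * ((d : ℝ) + 1) ^ 3 * r) :=
    Real.exp_le_exp.2 (add_le_add (mul_le_mul_of_nonneg_left hαa (by positivity)) (mul_le_mul_of_nonneg_left hrr (by positivity)))
  have hmono : ∀ {X Y s t K : ℝ}, 0 ≤ K → X ≤ Y → s ≤ t → 0 ≤ s → 0 < X → Y * (1 + K * t) ≤ 2 → X * (1 + K * s) ≤ 2 :=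
    fun hK hXY hst hs hX h => (mul_le_mul hXY (by nlinarith) (by positivity) (by linarith)).trans h
  -- the linear members: `slope · letter ≤ slope · bound ≤ target`
  have hfrac : ∀ {S x c : ℝ}, 0 ≤ S → 0 < c → x ≤ c / (S + 1) → S * x ≤ c := fun {S x c} hS hc hx => by
    have h1 : S * x ≤ S * (c / (S + 1)) := mul_le_mul_of_nonneg_left hx hS
    have h2 : S * (c / (S + 1)) ≤ c := by
      rw [mul_div_assoc', div_le_iff₀ (by positivity)]; nlinarith
    exact h1.trans h2
  refine ⟨α₀, ρ, r', hα₀0, hρ0, hr'0, ?_, ?_, ?_, ?_, hmono hK₁ hexp₁ hρp hρ0.le (Real.exp_pos _) h3, by linarith, ?_, ?_,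
    hmono hK₁ hexp₁ hrr hr'0.le (Real.exp_pos _) h5, by linarith, ?_, hmono hK₂ hexp₂ hρ7 hρ0.le (Real.exp_pos _) h8, by linarith, ?_, ?_, ?_⟩
  · exact (mul_le_mul_of_nonneg_left hαa (C0_pos d).le).trans h1
  · linarith
  · linarith
  · -- `50(d+1)·αT·L^d = Q·α₀ ≤ ½`
    have e : 50 * ((d : ℝ) + 1) * αT d L α₀ * (L : ℝ) ^ d = Q * α₀ := by rw [hQ]; unfold αT; ring
    rw [e]
    have h := hfrac hQ0 (by norm_num : (0 : ℝ) < 1 / 2) (hαQ.trans (le_of_eq (by rw [div_div])))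
    exact h
  · -- `2d·θ_gen = P·α₀ ≤ L³∕16`
    have e : 2 * (d : ℝ) * thetaGen d L α₀ = P * α₀ := by rw [hP]; unfold thetaGen; ring
    rw [e]
    exact hfrac hP0 (by positivity) (hαP.trans (le_of_eq (by rw [div_div])))
  · -- `2d·C₃^gen·ρ ≤ 1`
    have h := hfrac (show (0 : ℝ) ≤ 2 * (d : ℝ) * C3Gen d L by positivity) one_pos (hρG.trans (le_of_eq (by rw [one_div])))
    linarith
  · exact (mul_le_mul_of_nonneg_left hrr (by positivity)).trans h7
  · -- `d·C₃^cplx·ρ ≤ 1`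
    have h := hfrac (show (0 : ℝ) ≤ (d : ℝ) * C3Cplx d L by positivity) one_pos (hρX.trans (le_of_eq (by rw [one_div])))
    linarith
  · -- `ε^cplx(r′) = E·r′ ≤ 1∕16`
    rw [epsCplx_zero_eq, ← hE]
    have h1 : E * r' ≤ E * (1 / (32 * (((d : ℝ) + 1) * (E + B) + 1))) := mul_le_mul_of_nonneg_left hrE hE0
    have h2 : E * (1 / (32 * (((d : ℝ) + 1) * (E + B) + 1))) ≤ 1 / 16 := by
      rw [mul_one_div, div_le_div_iff₀ (by positivity) (by norm_num)]; nlinarith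
    linarith
  · -- `d·(ε^cplx(r′) + τ^cplx(α₀, r′)) = d·A·α₀ + d·(E + B)·r′ ≤ 1∕32 + 1∕32`
    rw [epsCplx_zero_eq, tauCplx_zero_eq, ← hE, ← hA, ← hB]
    have h1 : (d : ℝ) * A * α₀ ≤ (d : ℝ) * A * (1 / (32 * ((d : ℝ) * A + 1))) := mul_le_mul_of_nonneg_left hαA (by positivity)
    have h2 : (d : ℝ) * A * (1 / (32 * ((d : ℝ) * A + 1))) ≤ 1 / 32 := by
      rw [mul_one_div, div_le_div_iff₀ (by positivity) (by norm_num)]; nlinarith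
    have h3 : (d : ℝ) * (E + B) * r' ≤ (d : ℝ) * (E + B) * (1 / (32 * (((d : ℝ) + 1) * (E + B) + 1))) := mul_le_mul_of_nonneg_left hrE (by positivity)
    have h4 : (d : ℝ) * (E + B) * (1 / (32 * (((d : ℝ) + 1) * (E + B) + 1))) ≤ 1 / 32 := by
      rw [mul_one_div, div_le_div_iff₀ (by positivity) (by norm_num)]; nlinarith
    nlinarith

end Literature.MathematicalPhysics.QuantumFieldTheory.Balaban1983to89.B7Prop7RegimeNonVacuityClassFaces

end
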